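import Mathlib
import HarnessLib
import Literature.Analysis.FluidPDE.KNSSRegularityProofs
import Summits.NavierStokesRegularity.NavierStokesRegularity.Theorems.UnthreadedDoorAntidynamoWallSupersolutionComparison

/-!
# Route `UnthreadedDoor` / `ThreadingFlux`, crux `PoloidalLiouville` (stmt-NavierStokesRegularity-1222), antidynamo v2 skeleton
# (sha16 `4ebf5683127b`), WALL `stub_scalarLiouville`: KNSS's Lemma 2.1 (half-ball form) for SUBSOLUTIONS

Support file (seat leafhand-ns-unthreadeddoor-2 g5, cell decomp-ns), `--supports stmt-NavierStokesRegularity-1222 --as helper`; theorems only,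
general finite-dimensional real inner product space `E`.  Continues `…WallSupersolutionComparison` (comparison and propagation of positivity
for SUPERsolutions of the drift–heat class).

* ★★ `DriftHeatSub.halfball_of_subsolution` — if `f` (jointly continuous, `C²` slices, bounded jointly continuous `∇f, Δf`) satisfies the
  one-sided integrated law `f(t) − f(s) ≤ ∫ₛᵗ (Δf − Df·a)` with a bounded measurable drift `a`, is `≤ M₁` with `M₁ > 0` approached, then for
  every `R > 0` some parabolic ball `B(y₀,R) × (t₀ − R², t₀)` carries `f ≥ M₁/2` — the tree's `KNSS2009_lemma21_halfball_holds` with the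
  equation weakened to the subsolution inequality (proof copied; `v = M₁ − f` is a nonnegative supersolution).

This is the ENGINE-side interface for a ONE-SIDED closing of the wall in the spherical-mean gauge (`…WallOfSphereMeanSubEngine`).
HONEST LABEL: parabolic bookkeeping; nothing here proves `stub_scalarLiouville`, `PoloidalLiouville` (1222) or bears on NS regularity.
[cite: KochNadirashviliSereginSverak2009, Lemma 2.1 (arXiv:0709.3599 p. 5) — one-sided variant] [cite: Lieberman1996, Ch. II Lemma 2.6]
-/

noncomputable section

-- the summit and its single sub-problem share the name (CONVENTIONS §1)
set_option linter.dupNamespace false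

open MeasureTheory Set Function Filter Topology InnerProductSpace Metric
open scoped RealInnerProductSpace Laplacian ContDiff

namespace Summit.NavierStokesRegularity.NavierStokesRegularity.Theorems.PoloidalLiouville.Antidynamo

namespace DriftHeatSub

open Literature.Analysis.FluidPDE

variable {E : Type*} [NormedAddCommGroup E] [InnerProductSpace ℝ E] [FiniteDimensional ℝ E]
  [MeasurableSpace E] [BorelSpace E]

/-- ★★ **KNSS's Lemma 2.1 (half-ball form) for SUBsolutions.**  Let `f` be bounded above by `M₁ > 0` approached as a supremum on the slab
`t < 0`, with `C²` slices, bounded and jointly continuous `∇f, Δf`, jointly continuous `f`, and the one-sided integrated law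
`f(t) − f(s) ≤ ∫ₛᵗ (Δf − Df·a)` (`a` bounded measurable) — a SUBsolution of `fₜ + a·∇f − Δf ≤ 0`.  Then for every `R > 0` some parabolic
ball `B(y₀, R) × (t₀ − R², t₀)` carries `f ≥ M₁/2`.  Proof copied from the tree's `KNSS2009_lemma21_halfball_holds`: `v = M₁ − f ≥ 0` is a
supersolution, and propagation of positivity for supersolutions (`driftHeat_propagation_super`) contradicts `sup f = M₁` unless such balls
exist. [cite: KochNadirashviliSereginSverak2009, Lemma 2.1 (arXiv:0709.3599 p. 5) — one-sided variant] -/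
theorem halfball_of_subsolution {f : ℝ → E → ℝ} {a : ℝ → E → E} {A M₁ : ℝ}
    (ha_meas : Measurable (uncurry a)) (ha : ∀ t < 0, ∀ y, ‖a t y‖ ≤ A)
    (hf2 : ∀ t < 0, ContDiff ℝ 2 (f t))
    (hder : ∃ C : ℝ, ∀ t < 0, ∀ y, ‖fderiv ℝ (f t) y‖ ≤ C ∧ |(Δ (f t)) y| ≤ C)
    (hcD : ContinuousOn (fun p : ℝ × E => fderiv ℝ (f p.1) p.2) (Iio 0 ×ˢ univ))
    (hcΔ : ContinuousOn (fun p : ℝ × E => (Δ (f p.1)) p.2) (Iio 0 ×ˢ univ))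
    (hfc : ContinuousOn (uncurry f) (Iio 0 ×ˢ univ))
    (hsub : ∀ y, ∀ s t : ℝ, s ≤ t → t < 0 →
      f t y - f s y ≤ ∫ τ in s..t, ((Δ (f τ)) y - fderiv ℝ (f τ) y (a τ y)))
    (hM : ∀ t < 0, ∀ y, f t y ≤ M₁) (happ : ∀ ε > 0, ∃ t < 0, ∃ y, M₁ - ε < f t y) (hM₁ : 0 < M₁) :
    ∀ R > 0, ∃ y₀ : E, ∃ t₀ < (0 : ℝ),
      ∀ t ∈ Ioo (t₀ - R ^ 2) t₀, ∀ y ∈ Metric.ball y₀ R, M₁ / 2 ≤ f t y := by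
  intro R hR
  obtain ⟨C, hC⟩ := hder
  -- pass to `v = M₁ - f ≥ 0`, which lies in the same class
  set v : ℝ → E → ℝ := fun t y => M₁ - f t y with hv
  have hv2 : ∀ t < 0, ContDiff ℝ 2 (v t) := fun t ht => contDiff_const.sub (hf2 t ht)
  have hvD : ∀ t < 0, ∀ y, fderiv ℝ (v t) y = -fderiv ℝ (f t) y := fun t _ y =>
    fderiv_const_sub M₁
  have hvΔ : ∀ t < 0, ∀ y, (Δ (v t)) y = -(Δ (f t)) y := by
    intro t ht y
    have h1 : v t = (fun _ : E => M₁) - f t := rfl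
    rw [h1, contDiffAt_const.laplacian_sub (hf2 t ht).contDiffAt, laplacian_const]
    simp
  have hbd : ∀ t < 0, ∀ y, ‖fderiv ℝ (v t) y‖ ≤ C ∧ |(Δ (v t)) y| ≤ C := by
    intro t ht y
    rw [hvD t ht y, hvΔ t ht y, norm_neg, abs_neg]
    exact hC t ht y
  have hcD' : ContinuousOn (fun p : ℝ × E => fderiv ℝ (v p.1) p.2) (Iio 0 ×ˢ univ) :=
    hcD.neg.congr fun p hp => hvD p.1 hp.1 p.2
  have hcΔ' : ContinuousOn (fun p : ℝ × E => (Δ (v p.1)) p.2) (Iio 0 ×ˢ univ) :=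
    hcΔ.neg.congr fun p hp => hvΔ p.1 hp.1 p.2
  have hvc' : ContinuousOn (uncurry v) (Iio 0 ×ˢ univ) := by
    have : uncurry v = fun p : ℝ × E => M₁ - uncurry f p := by
      funext p; rfl
    rw [this]
    exact continuousOn_const.sub hfc
  have hsuper' : ∀ y, ∀ s t : ℝ, s ≤ t → t < 0 →
      ∫ τ in s..t, ((Δ (v τ)) y - fderiv ℝ (v τ) y (a τ y)) ≤ v t y - v s y := by
    intro y s t hst ht
    have h1 : ∫ τ in s..t, ((Δ (v τ)) y - fderiv ℝ (v τ) y (a τ y)) =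
        ∫ τ in s..t, -((Δ (f τ)) y - fderiv ℝ (f τ) y (a τ y)) := by
      refine intervalIntegral.integral_congr fun τ hτ => ?_
      rw [uIcc_of_le hst] at hτ
      have hτ0 : τ < 0 := lt_of_le_of_lt hτ.2 ht
      simp only [hvD τ hτ0, hvΔ τ hτ0, neg_apply]
      ring
    rw [h1, intervalIntegral.integral_neg]
    have h2 := hsub y s t hst ht
    simp only [hv]
    linarith
  have hv0 : ∀ t < 0, ∀ y, 0 ≤ v t y := fun t ht y => sub_nonneg.2 (hM t ht y)
  -- propagation of positivity for `v`, with `μ = M₁ / 2`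
  obtain ⟨ε₀, hε₀, hprop⟩ := driftHeat_propagation_super ha_meas ha hv2 hbd hcD' hcΔ' hvc' hsuper' hv0
    (half_pos hM₁) hR
  by_contra H
  push Not at H
  -- every parabolic ball of radius `R` contains a point with `f < M₁ / 2`; hence `f ≤ M₁ - ε₀`
  have hclaim : ∀ t < 0, ∀ y, f t y ≤ M₁ - ε₀ := by
    intro t ht y
    obtain ⟨t₁, ht₁, y₁, hy₁, hlt⟩ := H y (t - 1) (by linarith)
    have ht₁0 : t₁ < 0 := by linarith [ht₁.2]
    have hμ : M₁ / 2 < v t₁ y₁ := by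
      simp only [hv]
      linarith
    have hyy : ‖y - y₁‖ < R := by
      rw [← dist_eq_norm, dist_comm]
      exact hy₁
    have := hprop t₁ ht₁0 y₁ hμ t ⟨by linarith [ht₁.2], by linarith [ht₁.1]⟩ ht y hyy
    simp only [hv] at this
    linarith
  obtain ⟨t, ht, y, hy⟩ := happ ε₀ hε₀
  linarith [hclaim t ht y]


end DriftHeatSub

end Summit.NavierStokesRegularity.NavierStokesRegularity.Theorems.PoloidalLiouville.Antidynamo
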